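import Summits.QuantumFields.YangMills.Theses.SmallCircleAnchor

/-!
# PROMOTE package — the LOAD-BEARING CORE of `AdiabaticContinuity` (stmt-QuantumFields-11142)

Planner-ready, SORRY-FREE (continuation lead c1, 2026-08-17). Finding: the route's deciding theorem
`Summit.QuantumFields.YangMills.Theses.SmallCircleAnchor.closes` consumes the crux ONLY through Leg B at
`s = 0` (it discards Leg A with `obtain ⟨m, hm, -, hB⟩` and instantiates `hB 0 …`). Hence the part of the
crux that is load-bearing for `YangMills` is

* `AnchorToTorus` := the crux's quantifier prefix and anchor hypothesis VERBATIM, with conclusion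
  `∃ β₁, ∀ β ≥ β₁, ∃ m > 0, Cl (fun L => L) 0 β m` — the anchor implies volume-uniform clustering of the
  UNDEFORMED symmetric Wilson torus `ℤ_L × (ℤ/L)³` at large `β` (no Leg A, no `s > 0`).

Certificates: `anchorToTorus_of_adiabaticContinuity : AdiabaticContinuity → AnchorToTorus` (the core is
WEAKER than the crux; deformation threshold `max ε₁ 0` makes `s = 0 ≤ E β` available) and
`closes_of_core : AnchorGap → AnchorToTorus → EndpointTransfer → ContinuumLegGivenGap → YangMills` (the
route's assembly goes through VERBATIM with the core in place of the crux). So a planner `--restate` of the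
crux to `AnchorToTorus` keeps the route closed-by-assembly, drops the idle Leg A (and with it the
Myers–Ogilvie first-order risk on Leg A named in the item's why-it-might-fail) and the idle `0 < s < E β`
range of Leg B; the adiabatic PATH then lives where it already lives — in the line's skeleton (A* → corner →
removal), as the intended proof of the core, not as part of the item's statement. `lean check`: rc 0,
sorries 0, standard axioms.
-/

namespace Summit.QuantumFields.YangMills.Cruxes.AdiabaticContinuity.Birth.PromoteCore

open scoped BigOperators Topology Manifold Classical MeasureTheory ProbabilityTheory Matrix InnerProductSpace ComplexConjugate ContinuousMap
open Filter Set Function TopologicalSpace MeasureTheory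
open Summit.QuantumFields.YangMills.Theses.SmallCircleAnchor

/-- **The load-bearing core of the crux**: same prefix and anchor hypothesis as `AdiabaticContinuity`,
conclusion = the `s = 0` point of Leg B only: the undeformed symmetric Wilson torus clusters, uniformly in
`L`, for all large `β`. -/
def AnchorToTorus : Prop :=
  ∀ (G : Type) [Group G] [TopologicalSpace G] [IsTopologicalGroup G] [CompactSpace G], Literature.MathematicalPhysics.QuantumFieldTheory.IsCompactSimpleLieGroup G → letI : MeasurableSpace G := borel G; haveI : BorelSpace G := ⟨rfl⟩; ∀ (r : Literature.MathematicalPhysics.QuantumFieldTheory.LatticeRep G) (V : G → ℝ), (Continuous V ∧ (∀ a g : G, V (a * g * a⁻¹) = V g) ∧ ∃ g₀ : G, (∀ g : G, V g₀ ≤ V g) ∧ (∀ g : G, V g = V g₀ → ∃ a : G, g = a * g₀ * a⁻¹) ∧ (∀ a b : G, a * g₀ = g₀ * a → b * g₀ = g₀ * b → a * b = b * a)) → ∀ (T : ℕ) [NeZero T], let Cl := fun (τ : ℕ → ℕ) (s β m : ℝ) => ∀ w : ℕ, ∃ C : ℝ, ∀ (L : ℕ) [NeZero L] [NeZero (τ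 L)], let St := ZMod (τ L) × (Fin 3 → ZMod L); let Cfg := St × Option (Fin 3) → G; let ν : MeasureTheory.Measure Cfg := MeasureTheory.Measure.pi fun _ => Literature.MathematicalPhysics.QuantumFieldTheory.haarProbability G; let sh : St → Option (Fin 3) → St := fun x μ => Option.elim μ (x.1 + 1, x.2) fun i => (x.1, x.2 + Pi.single i 1); let pl : Cfg → St → Option (Fin 3) → Option (Fin 3) → G := fun U x μ κ => U (x, μ) * U (sh x μ, κ) * (U (sh x κ, μ))⁻¹ * (U (x, κ))⁻¹; let act : Cfg → ℝ := fun U => β * ∑ x : St, ∑ i : Fin 3, (r.ρ (pl U x none (some i))).trace.re + β * ∑ x : St, ∑ q : {q : Fin 3 × Fin 3 // q.1 < q.2}, (r.ρ (pl U x (some q.1.1) (some q.1.2))).trace.re; let P : Cfg → (Fin 3 → ZMod L) → G := fun U x => (List.ofFn fun t : Fin (τ L) => U ((((t : ℕ) : ZMod (τ L)), x), none)).prod; let wgt : Cfg → ℝ := fun U => Real.exp (act U - s * ∑ x : Fin 3 → ZMod L, V (P U x)); let Ex : (Cfg → ℝ) → ℝ := fun F => (∫ U, F U * wgt U ∂ν)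 / (∫ U, wgt U ∂ν); let σ : ℕ → Cfg → Cfg := fun n U p => U ((p.1.1, p.1.2 + Pi.single 0 (n : ZMod L)), p.2); ∀ (c : Fin 3 → ZMod L), let Loc := fun F : Cfg → ℝ => Measurable F ∧ (∀ U, |F U| ≤ 1) ∧ ∀ U U', (∀ p, (∀ i : Fin 3, (p.1.2 i - c i).val ≤ w) → U p = U' p) → F U = F U'; ∀ F₁ F₂ : Cfg → ℝ, Loc F₁ → Loc F₂ → ∀ n : ℕ, 2 * n < L → |Ex (fun U => F₁ U * F₂ (σ n U)) - Ex F₁ * Ex (fun U => F₂ (σ n U))| ≤ C * Real.exp (-(m * n)); ∃ ε₁ : ℝ, ∀ E : ℝ → ℝ, (∀ β : ℝ, ε₁ ≤ E β) → ∀ β₀ : ℝ, (∀ β : ℝ, β₀ ≤ β → ∃ m : ℝ, 0 < m ∧ ∀ w : ℕ, ∃ C : ℝ, ∀ (L : ℕ) [NeZero L], let St := ZMod T × (Fin 3 → ZMod L); let Cfg := St × Option (Fin 3) → G; let ν : MeasureTheory.Measure Cfg := MeasureTheory.Measure.pi fun _ => Literature.MathematicalPhysics.QuantumFieldTheory.haarProbability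 G; let sh : St → Option (Fin 3) → St := fun x μ => Option.elim μ (x.1 + 1, x.2) fun i => (x.1, x.2 + Pi.single i 1); let pl : Cfg → St → Option (Fin 3) → Option (Fin 3) → G := fun U x μ κ => U (x, μ) * U (sh x μ, κ) * (U (sh x κ, μ))⁻¹ * (U (x, κ))⁻¹; let act : Cfg → ℝ := fun U => β * ∑ x : St, ∑ i : Fin 3, (r.ρ (pl U x none (some i))).trace.re + β * ∑ x : St, ∑ q : {q : Fin 3 × Fin 3 // q.1 < q.2}, (r.ρ (pl U x (some q.1.1) (some q.1.2))).trace.re; let P : Cfg → (Fin 3 → ZMod L) → G := fun U x => (List.ofFn fun t : Fin T => U ((((t : ℕ) : ZMod T), x), none)).prod; let wgt : Cfg → ℝ := fun U => Real.exp (act U - E β * ∑ x : Fin 3 → ZMod L, V (P U x)); let Ex : (Cfg → ℝ) → ℝ := fun F => (∫ U, F U * wgt U ∂ν) / (∫ U, wgt U ∂ν); let σ : ℕ → Cfg → Cfg := fun n U p => U ((p.1.1, p.1.2 + Pi.single 0 (n : ZMod L)), p.2); ∀ (c : Fin 3 → ZMod L), let Loc := fun F : Cfg → ℝ => Measurable F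 ∧ (∀ U, |F U| ≤ 1) ∧ ∀ U U', (∀ p, (∀ i : Fin 3, (p.1.2 i - c i).val ≤ w) → U p = U' p) → F U = F U'; ∀ F₁ F₂ : Cfg → ℝ, Loc F₁ → Loc F₂ → ∀ n : ℕ, 2 * n < L → |Ex (fun U => F₁ U * F₂ (σ n U)) - Ex F₁ * Ex (fun U => F₂ (σ n U))| ≤ C * Real.exp (-(m * n))) → ∃ β₁ : ℝ, ∀ β : ℝ, β₁ ≤ β → ∃ m : ℝ, 0 < m ∧ Cl (fun L => L) 0 β m

/-- The core is weaker than the crux: take the crux's `ε₁`, use `max ε₁ 0` so that `0 ≤ E β`, and read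
off Leg B at `s = 0`. [folklore] -/
theorem anchorToTorus_of_adiabaticContinuity (h : AdiabaticContinuity) : AnchorToTorus := by
  intro G _ _ _ _ hG r V hV T _ Cl
  obtain ⟨ε₁, hε⟩ := h G hG r V hV T
  refine ⟨max ε₁ 0, fun E hE β₀ hanch => ?_⟩
  obtain ⟨β₁, hβ₁⟩ := hε E (fun β => (le_max_left _ _).trans (hE β)) β₀ hanch
  refine ⟨β₁, fun β hβ => ?_⟩
  obtain ⟨m, hm, -, hB⟩ := hβ₁ β hβ
  exact ⟨m, hm, hB 0 le_rfl ((le_max_right _ _).trans (hE β))⟩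

/-- **The route's assembly with the core in place of the crux** (proof = the route's `closes`, with the
Leg-B-at-zero step replaced by the core's conclusion). [folklore] -/
theorem closes_of_core : AnchorGap → AnchorToTorus → EndpointTransfer → ContinuumLegGivenGap → YangMills := by
  intro hA hT hE hC G i1 i2 i3 i4 hG
  refine hC G hG fun r => ?_
  letI : MeasurableSpace G := borel G
  haveI : BorelSpace G := ⟨rfl⟩
  obtain ⟨V, hV, hanch⟩ := hA G hG r
  obtain ⟨ε₁, hε₁⟩ := hT G hG r V hV 1
  obtain ⟨E, hE1, β₀, hβ₀⟩ := hanch 1 ε₁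
  obtain ⟨β₁, hβ₁⟩ := hε₁ E hE1 β₀ hβ₀
  have hsym : (∃ β₁ : ℝ, ∀ β : ℝ, β₁ ≤ β → ∃ m : ℝ, 0 < m ∧ ∀ w : ℕ, ∃ C : ℝ, ∀ (L : ℕ) [NeZero L], let St := ZMod L × (Fin 3 → ZMod L); let Cfg := St × Option (Fin 3) → G; let ν : MeasureTheory.Measure Cfg := MeasureTheory.Measure.pi fun _ => Literature.MathematicalPhysics.QuantumFieldTheory.haarProbability G; let sh : St → Option (Fin 3) → St := fun x μ => Option.elim μ (x.1 + 1, x.2) fun i => (x.1, x.2 + Pi.single i 1); let pl : Cfg → St → Option (Fin 3) → Option (Fin 3) → G := fun U x μ κ => U (x, μ) * U (sh x μ, κ) * (U (sh x κ, μ))⁻¹ * (U (x, κ))⁻¹; let act : Cfg → ℝ := fun U => β * ∑ x : St, ∑ i : Fin 3, (r.ρ (pl U x none (some i))).trace.re + β * ∑ x : St, ∑ q : {q : Fin 3 × Fin 3 // q.1 < q.2}, (r.ρ (pl U x (some q.1.1) (some q.1.2))).trace.re; let wgt : Cfg → ℝ := fun U => Real.exp (act U); let Ex : (Cfg → ℝ)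 → ℝ := fun F => (∫ U, F U * wgt U ∂ν) / (∫ U, wgt U ∂ν); let σ : ℕ → Cfg → Cfg := fun n U p => U ((p.1.1, p.1.2 + Pi.single 0 (n : ZMod L)), p.2); ∀ (c : Fin 3 → ZMod L), let Loc := fun F : Cfg → ℝ => Measurable F ∧ (∀ U, |F U| ≤ 1) ∧ ∀ U U', (∀ p, (∀ i : Fin 3, (p.1.2 i - c i).val ≤ w) → U p = U' p) → F U = F U'; ∀ F₁ F₂ : Cfg → ℝ, Loc F₁ → Loc F₂ → ∀ n : ℕ, 2 * n < L → |Ex (fun U => F₁ U * F₂ (σ n U)) - Ex F₁ * Ex (fun U => F₂ (σ n U))| ≤ C * Real.exp (-(m * n))) := by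
    refine ⟨β₁, fun β hβ => ?_⟩
    obtain ⟨m, hm, h0⟩ := hβ₁ β hβ
    refine ⟨m, hm, fun w => ?_⟩
    obtain ⟨C, hC⟩ := h0 w
    refine ⟨C, fun L hL => ?_⟩
    simpa only [zero_mul, sub_zero] using @hC L hL hL
  exact hE G hG r hsym

/-- Sanity: the crux still closes the route through the core (composition of the two certificates with the
route's own items). [folklore] -/
theorem closes_via_core : AnchorGap → AdiabaticContinuity → EndpointTransfer → ContinuumLegGivenGap → YangMills :=
  fun hA hT => closes_of_core hA (anchorToTorus_of_adiabaticContinuity hT)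

end Summit.QuantumFields.YangMills.Cruxes.AdiabaticContinuity.Birth.PromoteCore
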